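import Mathlib.Analysis.SpecialFunctions.Trigonometric.Deriv
import Mathlib.Analysis.SpecialFunctions.Trigonometric.Basic
import Mathlib.Analysis.SpecialFunctions.Trigonometric.Inverse
import Mathlib.Analysis.Calculus.Deriv.Basic
import Mathlib.Algebra.BigOperators.Group.Finset.Basic
import Mathlib.Algebra.BigOperators.Ring.Finset
import Mathlib.Tactic.FieldSimp
import Mathlib.Tactic.Ring
import Mathlib.Tactic.Linarith
import HarnessLib

/-!
# Frequency-droop-controlled inverter networks (Simpson-Porco–Dörfler–Bullo), as printed

Topic `Literature/MathematicalPhysics/PowerSystems` (LADDER-GRIDFUSION rung G3, model row «inverter,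
frequency droop»; seat gridfusion-lit-2).  Companion of `ClassicalSwingModel.lean` (synchronous
machines) and `StructurePreservingModel.lean` (Bergen–Hill).

Source: J. W. Simpson-Porco, F. Dörfler, F. Bullo, «Synchronization and power sharing for
droop-controlled inverters in islanded microgrids», Automatica 49 (2013) = arXiv:1206.5033
[SimpsonporcoDorflerBullo2013].  The held copy is the arXiv LaTeX source, whose equations carry
LABELS rather than numbers; locators below use those labels together with the section.

Printed objects typed here:
* the frequency-droop law `ω_i = ω* − n_i (P_e,i − P_i*)` (§1, eq. (Droop)): an inverter is «a
  controlled voltage source behind a reactance» (§2) whose frequency is set by this proportional law;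
* with `D_i ≜ n_i⁻¹` and `ω_i = ω* + dθ_i/dt` the same law reads `D_i dθ_i/dt = P_i* − P_e,i`
  (§3, eq. (BasicKuraDroop)) — `droopLaw_iff`;
* the active power injections `P_e,i = Σ_j E_iE_j|Y_ij| sin(θ_i − θ_j)` for inductive lines and
  constant voltage amplitudes, giving the closed loop
  `D_i dθ_i/dt = P_i* − Σ_j E_iE_j|Y_ij| sin(θ_i − θ_j)`, `i ∈ V_I` (eq. (KuraDroop)) together with the
  load power balances `0 = P_i* − Σ_j E_iE_j|Y_ij| sin(θ_i − θ_j)`, `i ∈ V_L` (eq. (PowerBal)) —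
  one equation shape with `D_i = 0` at load nodes, exactly as the paper's matrix
  `D = diag(0_{|V_L|}, {D_i}_{i∈V_I})` (text before eq. (CombinedKuraDroop));
* the coupling weights `a_ij ≜ E_iE_j|Y_ij|` and Lemma 1 (the closed loop IS a generalized
  first-order Kuramoto model with `Ω_i = P_i*`, `a_ij = E_iE_j|Y_ij|`) — here definitional;
* the scaled power imbalance `ω_avg ≜ (Σ_{i=1}^{n} P_i*)/(Σ_{i∈V_I} D_i)` of Theorem 2 and the first
  step of its proof, PROVED: «Summing over all equations (KuraDroop)–(PowerBal) gives
  ω_sync = ω_avg» for any frequency-synchronized solution, and `Σ_i P̃_i = 0` for the shifted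
  injections `P̃_i = P_i* − ω_avg D_i` (eq. (Aux)).

## Three columns
MODELLED only: inductive (lossless) lines, constant voltage amplitudes `E_i`, instantaneous
frequency actuation, rolling-average power measurement idealised away (§2–§3 of the source).  This
is a GRID-FORMING voltage-source model; grid-following (PLL) inverters are NOT this model.  The
sin-only nonlinearity makes the model polynomialisable exactly like the swing equation.

## Theorem 2 layer (appended by gridfusion-lit-2 g2)
The objects of Theorem 2 (Existence and Stability of Sync'd Solution) in the paper's vector notation:
an oriented edge list with node–edge incidence matrix `B` (`EdgeList`, `inc`, `diff = Bᵀx`,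
`div = Bξ`), the edge power flows `diag({a_ij}) sin(Bᵀθ)` (`edgeFlow`), the arc condition
`θ ∈ Δ_G(γ)` on real angle lifts (`InArc`), the KCL flow equation `P̃ = Bξ` (`IsKCLFlow`), the
flow-feasibility condition `‖diag({a_ij})⁻¹ξ‖_∞ < 1` written componentwise (`FlowFeasible`), the
equilibria of the rotating-frame system (Aux) (`IsAuxEquilibrium`) and the rate (λ) of statement (b)
(`syncRateBound`, definition only).  PROVED: the vector form
`P_e,i(θ) = (B diag({a_ij}) sin(Bᵀθ))_i` for an edge list representing the network; synchronized
solutions ↔ (Aux)-equilibria (both directions); the NECESSITY half «(i) ⇒ (ii)» of Theorem 2 together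
with statement (a) for ANY topology — an (Aux)-equilibrium in `Δ_G(γ)`, `γ ∈ [0, π/2[`, makes
`ξ = diag({a_ij}) sin(Bᵀθ*)` a KCL flow with `|ξ_ℓ| ≤ a_ℓ sin γ < a_ℓ`; and the algebraic converse
step (Eq:ReducedDorfler) «KCL flow `ξ` with `sin(Bᵀθ) = diag({a_ij})⁻¹ξ` ⇒ θ is an (Aux)-equilibrium».

Part 2 (acyclic networks): acyclicity as an attachment order of the edge list (`Acyclic`); PROVED
tree solvability `∀ y ∃ x, Bᵀx = y` (`exists_diff_eq`), `ker B = ∅` (`eq_zero_of_div_eq_zero`,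
`div_injective` — uniqueness of the KCL flow), the SUFFICIENCY/existence half «(ii) ⇒ (i)»
(`exists_isAuxEquilibrium_of_flowFeasible`: `Bᵀθ* = arcsin(diag({a_ij})⁻¹ξ)`), and the equivalence
(i) ⇔ (ii) at the level of synchronized solutions (`flowFeasible_iff_exists_isAuxEquilibrium`).

## What is NOT here
The local exponential STABILITY of the synchronized solution is proved DOWNSTREAM for all-inverter
networks (`DroopSyncExponentialStability.lean`: `DroopNetwork.syncSolution_locally_expStable`, and
Theorem 2 (i) ⇔ (ii) with «locally exponentially stable and unique» as
`DroopNetwork.flowFeasible_iff_exists_unique_expStable_sync`); the rate (b) (Kuramoto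
linearisation, [FD-FB:11d]) and the stability clause WITH LOAD NODES (`D_i = 0`, the DAE) are not
typed — no named fact is introduced for them; the folklore
equivalence «attachment order ⇔ forest» is not formalised (the order is the hypothesis); the
secondary controller's (§5, Theorem 8) local exponential STABILITY is not typed — its algebraic
part IS (§5 append: `IsDAPIEquilibrium`, `isDAPIEquilibrium_iff` = «the unique equilibrium is given as
in Theorem 2 (ii), along with p_i* = D_i ω_avg», `dapi_powerSharing`, `exists_isDAPIEquilibrium_iff`);
Corollary 4 (parallel inverters) is typed nodally in the §6 append (`IsParallel`,
`parallel_sync_iff_feasible`: existence of an in-arc synchronized solution ⇔ `Γ < 1`, stability clause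
not typed); the power-sharing results of §4 — Definition 6, Theorem 7 — ARE typed in the §4 append below: `ProportionalDroop`, `totalLoad`, `totalRating`,
`shiftedInjection_eq_of_proportional` (P_e,i = −P_L D_i/ΣD_j), `shiftedInjection_nonneg_iff`,
`shiftedInjection_le_rating_iff`, `powerSharing`, `injectionConstraints_iff_loadConstraint`,
`injection_eq_of_sync_of_proportional`); no voltage droop
(Schiffer et al. 2014: display equations not readable in the held copy, WANTED acq-11649 / acq-11739).
-/

noncomputable section

namespace Literature.MathematicalPhysics.PowerSystems

open Real Finset
open scoped BigOperators

/-- THE FREQUENCY-DROOP LAW of a voltage-source inverter: `ω_i = ω* − n_i (P_e,i − P_i*)` with rated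
frequency `ω*`, droop coefficient `n_i > 0`, measured active power injection `P_e,i` and nominal
injection `P_i*`. [cite: SimpsonporcoDorflerBullo2013, §1 eq. (Droop)] -/
def droopFrequency (ωstar nᵢ Pstar Pe : ℝ) : ℝ := ωstar - nᵢ * (Pe - Pstar)

/-- «by defining `D_i ≜ n_i⁻¹` and by writing `ω_i = ω* + θ̇_i`, we can equivalently write the
frequency-droop controller (Droop) as `D_i θ̇_i = P_i* − P_e,i`».
[cite: SimpsonporcoDorflerBullo2013, §3 eq. (BasicKuraDroop)] -/
theorem droopLaw_iff {nᵢ : ℝ} (hn : 0 < nᵢ) (ωstar Pstar Pe ω : ℝ) :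
    ω = droopFrequency ωstar nᵢ Pstar Pe ↔ nᵢ⁻¹ * (ω - ωstar) = Pstar - Pe := by
  unfold droopFrequency
  have hn' : nᵢ ≠ 0 := ne_of_gt hn
  constructor
  · intro h
    rw [h]
    field_simp
    ring
  · intro h
    have h' : ω - ωstar = nᵢ * (Pstar - Pe) := by
      have := congrArg (fun x => nᵢ * x) h
      rw [← mul_assoc, mul_inv_cancel₀ hn', one_mul] at this
      exact this
    linarith

/-- Data of a droop-controlled inverter network on `n` nodes (inverters `V_I` and loads `V_L` in one
index set): time constants `D_i = n_i⁻¹ > 0` at inverter nodes and `D_i = 0` at constant-power load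
nodes (the paper's `D = diag(0_{|V_L|}, {D_i}_{i∈V_I})`; a failed inverter has `D_i = P_i* = 0`),
nominal injections / loads `P_i*`, voltage amplitudes `E_i > 0`, and susceptance magnitudes `|Y_ij|`
of the (inductive) lines, `0` when not connected, inverter output reactances absorbed.
[cite: SimpsonporcoDorflerBullo2013, §2 and §3, text before eq. (CombinedKuraDroop)] -/
structure DroopNetwork (n : ℕ) where
  /-- time constants `D_i` (inverse droop coefficients; `0` at load nodes) -/
  Dc : Fin n → ℝ
  /-- nominal active power injections `P_i*` (negative = load / charging storage) -/
  Pstar : Fin n → ℝ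
  /-- nodal voltage amplitudes `E_i` -/
  E : Fin n → ℝ
  /-- line susceptance magnitudes `|Y_ij|` -/
  Yabs : Fin n → Fin n → ℝ

namespace DroopNetwork

variable {n : ℕ} (N : DroopNetwork n)

/-- Node `i` is an inverter node (`D_i > 0`). [cite: SimpsonporcoDorflerBullo2013, §3 Lemma 1 (i)] -/
def IsInverterNode (i : Fin n) : Prop := 0 < N.Dc i

/-- Node `i` is a constant-power load node (`D_i = 0`).
[cite: SimpsonporcoDorflerBullo2013, §3, text before eq. (CombinedKuraDroop)] -/
def IsLoadNode (i : Fin n) : Prop := N.Dc i = 0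

/-- Coupling weights `a_ij ≜ E_iE_j|Y_ij|` (the «physical maximum» active power flow of edge `{i,j}`).
[cite: SimpsonporcoDorflerBullo2013, §3, text before eq. (CombinedKuraDroop); Remark 3] -/
def a (i j : Fin n) : ℝ := N.E i * N.E j * N.Yabs i j

/-- Active power injection `P_e,i = Σ_j E_iE_j|Y_ij| sin(θ_i − θ_j)` (inductive lines, fixed
amplitudes). [cite: SimpsonporcoDorflerBullo2013, §3 eq. (KuraDroop)] -/
def injection (θ : Fin n → ℝ) (i : Fin n) : ℝ := ∑ j, N.a i j * Real.sin (θ i - θ j)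

/-- The closed-loop droop-controlled network at time `t`: every node has a frequency deviation
`w_i = dθ_i/dt` with `D_i w_i = P_i* − P_e,i(θ)` — eq. (KuraDroop) at inverter nodes, the algebraic
power balance eq. (PowerBal) at load nodes (`D_i = 0`).
[cite: SimpsonporcoDorflerBullo2013, §3 eqs. (KuraDroop), (PowerBal), (CombinedKuraDroop)] -/
def IsSolutionAt (θ : ℝ → Fin n → ℝ) (t : ℝ) : Prop :=
  ∀ i, ∃ w : ℝ, HasDerivAt (fun s => θ s i) w t ∧ N.Dc i * w = N.Pstar i - N.injection (θ t) i

/-- Lemma 1 in definitional form: the closed loop is the generalized Kuramoto model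
`D_i θ̇_i = Ω_i − Σ_j a_ij sin(θ_i − θ_j)` with `Ω_i = P_i*` and `a_ij = E_iE_j|Y_ij|` — i.e. the
right-hand side of (KuraDroop) literally is the Kuramoto right-hand side with these parameters.
[cite: SimpsonporcoDorflerBullo2013, §3 Lemma 1] -/
theorem kuramoto_form (θ : Fin n → ℝ) (i : Fin n) :
    N.Pstar i - N.injection θ i = N.Pstar i - ∑ j, N.E i * N.E j * N.Yabs i j * Real.sin (θ i - θ j) := by
  rfl

/-- The scaled power imbalance `ω_avg ≜ (Σ_{i=1}^{n} P_i*) / (Σ_{i∈V_I} D_i)`; summing `D_i` over all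
nodes is the same sum since `D_i = 0` on `V_L`. [cite: SimpsonporcoDorflerBullo2013, §3 Theorem 2] -/
def avgFrequency : ℝ := (∑ i, N.Pstar i) / ∑ i, N.Dc i

/-- Shifted injections `P̃_i = P_i* − ω_avg D_i` of the auxiliary system (Aux) (frame rotating at
`ω_avg`; `P̃_i = P_i*` on load nodes automatically). [cite: SimpsonporcoDorflerBullo2013, §3, proof of Theorem 2, eq. (Aux)] -/
def shiftedInjection (i : Fin n) : ℝ := N.Pstar i - N.avgFrequency * N.Dc i

/-- The injections of a network with symmetric `|Y_ij|` sum to zero (lossless lines):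
`Σ_i P_e,i(θ) = 0`. [cite: SimpsonporcoDorflerBullo2013, §3, proof of Theorem 2 («Summing over all equations»)] -/
theorem sum_injection_eq_zero (hY : ∀ i j, N.Yabs i j = N.Yabs j i) (θ : Fin n → ℝ) :
    ∑ i, N.injection θ i = 0 := by
  unfold injection
  have hswap : ∑ i, ∑ j, N.a i j * Real.sin (θ i - θ j)
      = -∑ i, ∑ j, N.a i j * Real.sin (θ i - θ j) := by
    conv_lhs => rw [Finset.sum_comm]
    simp only [← Finset.sum_neg_distrib]
    refine Finset.sum_congr rfl fun i _ => Finset.sum_congr rfl fun j _ => ?_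
    have ha : N.a j i = N.a i j := by unfold a; rw [hY j i]; ring
    rw [ha, ← neg_sub (θ i) (θ j), Real.sin_neg]
    ring
  linarith

/-- «`P̃ ∈ 1_n^⊥`»: the shifted injections sum to zero (needs `Σ D_i ≠ 0`, automatic with at least
one inverter node). [cite: SimpsonporcoDorflerBullo2013, §3, proof of Theorem 2, text after eq. (Aux)] -/
theorem sum_shiftedInjection_eq_zero (hD : ∑ i, N.Dc i ≠ 0) :
    ∑ i, N.shiftedInjection i = 0 := by
  simp only [shiftedInjection, Finset.sum_sub_distrib, avgFrequency]
  rw [← Finset.mul_sum, div_mul_cancel₀ _ hD, sub_self]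

/-- FIRST STEP OF THEOREM 2, proved: if a solution of (KuraDroop)–(PowerBal) is frequency
synchronized at time `t` (every node's angle has the same derivative `ω_sync`), then
`ω_sync = ω_avg` — «Summing over all equations (KuraDroop)–(PowerBal) gives ω_sync = ω_avg».
Hypotheses: `|Y|` symmetric, `Σ D_i ≠ 0`. [cite: SimpsonporcoDorflerBullo2013, §3 Theorem 2 (ii a) and its proof] -/
theorem syncFrequency_eq_avgFrequency (hY : ∀ i j, N.Yabs i j = N.Yabs j i)
    (hD : ∑ i, N.Dc i ≠ 0) {θ : ℝ → Fin n → ℝ} {t ωsync : ℝ} (hsol : N.IsSolutionAt θ t)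
    (hsync : ∀ i, HasDerivAt (fun s => θ s i) ωsync t) : ωsync = N.avgFrequency := by
  have hrow : ∀ i, N.Dc i * ωsync = N.Pstar i - N.injection (θ t) i := by
    intro i
    obtain ⟨w, hw, hEq⟩ := hsol i
    have : w = ωsync := hw.unique (hsync i)
    rw [← this]
    exact hEq
  have hsum : (∑ i, N.Dc i) * ωsync = ∑ i, N.Pstar i := by
    rw [Finset.sum_mul]
    simp only [hrow, Finset.sum_sub_distrib, N.sum_injection_eq_zero hY (θ t), sub_zero]
  unfold avgFrequency
  rw [eq_div_iff hD, mul_comm]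
  exact hsum


/-! ## Theorem 2 layer: incidence matrix, KCL flows, flow feasibility, (Aux)-equilibria

[cite: SimpsonporcoDorflerBullo2013, §1 «Algebraic graph theory», §3 eq. before Theorem 2
(vector notation), Theorem 2 with statements (a)–(b), Remark 3, and the proof up to
eq. (ReducedDorfler)].  Angles are carried as real lifts `θ : Fin n → ℝ` (the paper works on the
torus `𝕋ⁿ` with geodesic distances; for `|θ_i − θ_j| ≤ γ < π/2` along edges the two agree once a lift
is fixed — MODELLED). -/

/-- The injections are invariant under a uniform rotation of all angles (only differences enter) —
the reason the rotating frame of eq. (Aux) «represents the dynamics (CombinedKuraDroop) in a reference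
frame rotating at an angular frequency `ω_avg`».
[cite: SimpsonporcoDorflerBullo2013, §3, proof of Theorem 2, text after eq. (Aux)] -/
theorem injection_add_const (θ : Fin n → ℝ) (c : ℝ) (i : Fin n) :
    N.injection (fun j => θ j + c) i = N.injection θ i := by
  unfold injection
  refine Finset.sum_congr rfl fun j _ => ?_
  congr 1
  ring_nf

/-- EQUILIBRIA OF THE AUXILIARY SYSTEM (Aux): `D θ̇ = P̃ − B diag({a_ij}) sin(Bᵀθ)` in the frame
rotating at `ω_avg` has equilibria exactly where `P_e,i(θ) = P̃_i` for every node (inverter rows with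
`θ̇ = 0`, load rows verbatim since `P̃_i = P_i*` there).  «frequency synchronized solutions of
(CombinedKuraDroop) correspond one-to-one with equilibrium points of the system (Aux)» — see
`isSolutionAt_of_isAuxEquilibrium` / `isAuxEquilibrium_of_sync` below.
[cite: SimpsonporcoDorflerBullo2013, §3, proof of Theorem 2, eq. (Aux) and the sentence after it] -/
def IsAuxEquilibrium (θ : Fin n → ℝ) : Prop := ∀ i, N.injection θ i = N.shiftedInjection i

/-- (Aux)-equilibrium ⇒ synchronized solution, PROVED: if `θ₀` is an equilibrium of (Aux) then
`t ↦ θ₀ + (ω_avg t) 1_n` solves (KuraDroop)–(PowerBal) at every time, every node running at the common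
frequency `ω_avg` (statement (a): `θ*(t) = θ₀ + ω_sync t 1_n`, `ω_sync = ω_avg`).
[cite: SimpsonporcoDorflerBullo2013, §3 Theorem 2 (a) and proof (text after eq. (Aux))] -/
theorem isSolutionAt_of_isAuxEquilibrium {θ₀ : Fin n → ℝ} (h : N.IsAuxEquilibrium θ₀) (t : ℝ) :
    N.IsSolutionAt (fun s j => θ₀ j + N.avgFrequency * s) t := by
  intro i
  refine ⟨N.avgFrequency, ?_, ?_⟩
  · have h1 : HasDerivAt (fun s : ℝ => N.avgFrequency * s) (N.avgFrequency * 1) t :=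
      (hasDerivAt_id t).const_mul N.avgFrequency
    have h2 := h1.const_add (θ₀ i)
    simpa using h2
  · have hinv : N.injection (fun j => θ₀ j + N.avgFrequency * t) i = N.injection θ₀ i :=
      N.injection_add_const θ₀ (N.avgFrequency * t) i
    rw [hinv, h i]
    unfold shiftedInjection
    ring

/-- Synchronized solution ⇒ (Aux)-equilibrium, PROVED: if a solution of (KuraDroop)–(PowerBal) is
frequency synchronized at time `t` (all angles share the derivative `ω_sync`), then the angle array
`θ(t)` is an equilibrium of (Aux) (and `ω_sync = ω_avg`, `syncFrequency_eq_avgFrequency`).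
Hypotheses: `|Y|` symmetric, `Σ D_i ≠ 0`.
[cite: SimpsonporcoDorflerBullo2013, §3, proof of Theorem 2 (first paragraph)] -/
theorem isAuxEquilibrium_of_sync (hY : ∀ i j, N.Yabs i j = N.Yabs j i) (hD : ∑ i, N.Dc i ≠ 0)
    {θ : ℝ → Fin n → ℝ} {t ωsync : ℝ} (hsol : N.IsSolutionAt θ t)
    (hsync : ∀ i, HasDerivAt (fun s => θ s i) ωsync t) : N.IsAuxEquilibrium (θ t) := by
  have hω : ωsync = N.avgFrequency := N.syncFrequency_eq_avgFrequency hY hD hsol hsync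
  intro i
  obtain ⟨w, hw, hEq⟩ := hsol i
  have hwi : w = ωsync := hw.unique (hsync i)
  rw [hwi, hω] at hEq
  unfold shiftedInjection
  linarith

/-- AN ORIENTED EDGE LIST for the network graph `G(V, E, A)`: «if a number `ℓ ∈ {1,…,|E|}` and an
arbitrary direction is assigned to each edge `{i,j} ∈ E`», edge `ℓ` runs from its source node
`src ℓ` to its sink node `snk ℓ` and carries the coupling weight `a_ℓ = a_ij = E_iE_j|Y_ij|`
(`w ℓ`; tied to the nodal data by `EdgeList.Represents`).
[cite: SimpsonporcoDorflerBullo2013, §1 «Algebraic graph theory»; §3, text before eq. (CombinedKuraDroop)] -/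
structure EdgeList (n m : ℕ) where
  /-- source node of edge `ℓ` -/
  src : Fin m → Fin n
  /-- sink node of edge `ℓ` -/
  snk : Fin m → Fin n
  /-- edge weight `a_ℓ = E_iE_j|Y_ij|` of edge `ℓ = {i,j}` -/
  w : Fin m → ℝ

namespace EdgeList

variable {m : ℕ} (E : EdgeList n m)

/-- THE NODE–EDGE INCIDENCE MATRIX `B ∈ ℝ^{|V|×|E|}`: «`B_kℓ = 1` if node `k` is the sink node of edge
`ℓ` and `B_kℓ = −1` if node `k` is the source node of edge `ℓ`, with all other elements being zero».
[cite: SimpsonporcoDorflerBullo2013, §1 «Algebraic graph theory»] -/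
def inc (k : Fin n) (ℓ : Fin m) : ℝ :=
  (if E.snk ℓ = k then 1 else 0) - (if E.src ℓ = k then 1 else 0)

/-- `(Bᵀx)_ℓ`: «for `x ∈ ℝ^{|V|}`, `Bᵀx ∈ ℝ^{|E|}` is the vector with components `x_i − x_j`, with
`{i,j} ∈ E`» (sink minus source with the sign convention of `inc`).
[cite: SimpsonporcoDorflerBullo2013, §1 «Algebraic graph theory»] -/
def diff (x : Fin n → ℝ) (ℓ : Fin m) : ℝ := x (E.snk ℓ) - x (E.src ℓ)

/-- `(Bξ)_k = Σ_ℓ B_kℓ ξ_ℓ`: the nodal injection pattern produced by edge flows `ξ` (net inflow at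
node `k` with the orientation of `inc`). [cite: SimpsonporcoDorflerBullo2013, §1 («KCL `x = Bξ`»)] -/
def div (ξ : Fin m → ℝ) (k : Fin n) : ℝ := ∑ ℓ, E.inc k ℓ * ξ ℓ

/-- Edge power flows `(diag({a_ij}) sin(Bᵀθ))_ℓ = a_ℓ sin(θ_i − θ_j)` of an angle array.
[cite: SimpsonporcoDorflerBullo2013, §3 eq. before Theorem 2; Theorem 2 (a)] -/
def edgeFlow (θ : Fin n → ℝ) (ℓ : Fin m) : ℝ := E.w ℓ * Real.sin (E.diff θ ℓ)

/-- `θ ∈ Δ_G(γ)`: «the closed set of angle arrays … with neighboring angles `θ_i` and `θ_j`,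
`{i,j} ∈ E` no further than `γ` apart» — on real lifts: `|θ_i − θ_j| ≤ γ` along every edge.
[cite: SimpsonporcoDorflerBullo2013, §1 «Geometry on the n-torus»] -/
def InArc (γ : ℝ) (θ : Fin n → ℝ) : Prop := ∀ ℓ, |E.diff θ ℓ| ≤ γ

/-- The edge list REPRESENTS the droop network `N`: no self-loops, and for every pair of distinct
nodes the coupling weight `a_ij = E_iE_j|Y_ij|` is the total weight of the listed edges joining `i`
and `j` (either orientation; `0` when none) — i.e. `L = B diag({a_ij}) Bᵀ` is the Laplacian of the
weighted graph with adjacency `a`. [cite: SimpsonporcoDorflerBullo2013, §1 («the Laplacian matrix is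
given by `L = B diag({a_ij}) Bᵀ`»); §3, text before eq. (CombinedKuraDroop)] -/
def Represents (N : DroopNetwork n) : Prop :=
  (∀ ℓ, E.src ℓ ≠ E.snk ℓ) ∧
    ∀ i j, i ≠ j → N.a i j =
      ∑ ℓ, ((if E.snk ℓ = i ∧ E.src ℓ = j then E.w ℓ else 0)
              + (if E.src ℓ = i ∧ E.snk ℓ = j then E.w ℓ else 0))

/-- `(Bᵀx)_ℓ = Σ_k B_kℓ x_k` — the componentwise description «the vector with components
`x_i − x_j`» agrees with the matrix product `Bᵀx`.
[cite: SimpsonporcoDorflerBullo2013, §1 «Algebraic graph theory»] -/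
theorem diff_eq_sum_inc (x : Fin n → ℝ) (ℓ : Fin m) : E.diff x ℓ = ∑ k, E.inc k ℓ * x k := by
  unfold diff inc
  simp only [sub_mul, Finset.sum_sub_distrib, ite_mul, one_mul, zero_mul, Finset.sum_ite_eq,
    Finset.mem_univ, if_true]

/-- Every column of `B` sums to zero (`1ᵀB = 0`), hence `Σ_k (Bξ)_k = 0`: edge flows redistribute,
they do not create, injections — consistent with `Σ_i P̃_i = 0` (`sum_shiftedInjection_eq_zero`).
[cite: SimpsonporcoDorflerBullo2013, §1 («`ker(Bᵀ) = span(1)`»)] -/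
theorem sum_div_eq_zero (ξ : Fin m → ℝ) : ∑ k, E.div ξ k = 0 := by
  unfold div
  rw [Finset.sum_comm]
  refine Finset.sum_eq_zero fun ℓ _ => ?_
  rw [← Finset.sum_mul]
  have : ∑ k, E.inc k ℓ = 0 := by
    unfold inc
    simp only [Finset.sum_sub_distrib, Finset.sum_ite_eq, Finset.mem_univ, if_true, sub_self]
  rw [this, zero_mul]

/-- THE VECTOR FORM, PROVED: for an edge list representing the network,
`P_e,i(θ) = Σ_j a_ij sin(θ_i − θ_j) = (B diag({a_ij}) sin(Bᵀθ))_i`, i.e. the closed loop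
(KuraDroop)–(PowerBal) «reads in vector notation as `D θ̇ = P* − B diag({a_ij}) sin(Bᵀθ)`».
[cite: SimpsonporcoDorflerBullo2013, §3, eq. before Theorem 2] -/
theorem injection_eq_div_edgeFlow {N : DroopNetwork n} (hE : E.Represents N) (θ : Fin n → ℝ)
    (i : Fin n) : N.injection θ i = E.div (E.edgeFlow θ) i := by
  classical
  obtain ⟨_, ha⟩ := hE
  -- replace each `a_ij sin(θ_i − θ_j)` by the edge sum (the diagonal term vanishes: `sin 0 = 0`)
  have hterm : ∀ j, N.a i j * Real.sin (θ i - θ j) =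
      ∑ ℓ, ((if E.snk ℓ = i ∧ E.src ℓ = j then E.w ℓ else 0)
              + (if E.src ℓ = i ∧ E.snk ℓ = j then E.w ℓ else 0)) * Real.sin (θ i - θ j) := by
    intro j
    by_cases hij : i = j
    · subst hij
      simp [sub_self, Real.sin_zero]
    · rw [ha i j hij, Finset.sum_mul]
  unfold injection
  simp_rw [hterm]
  rw [Finset.sum_comm]
  unfold div edgeFlow inc diff
  refine Finset.sum_congr rfl fun ℓ _ => ?_
  simp_rw [add_mul, Finset.sum_add_distrib]
  have h1 : ∑ j, (if E.snk ℓ = i ∧ E.src ℓ = j then E.w ℓ else 0) * Real.sin (θ i - θ j)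
      = (if E.snk ℓ = i then 1 else 0) * (E.w ℓ * Real.sin (θ (E.snk ℓ) - θ (E.src ℓ))) := by
    by_cases hs : E.snk ℓ = i
    · simp only [hs, true_and, if_true, one_mul]
      rw [Finset.sum_eq_single (E.src ℓ)]
      · simp
      · intro j _ hj
        simp [Ne.symm hj]
      · simp
    · simp [hs]
  have h2 : ∑ j, (if E.src ℓ = i ∧ E.snk ℓ = j then E.w ℓ else 0) * Real.sin (θ i - θ j)
      = -((if E.src ℓ = i then 1 else 0) * (E.w ℓ * Real.sin (θ (E.snk ℓ) - θ (E.src ℓ)))) := by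
    by_cases hs : E.src ℓ = i
    · simp only [hs, true_and, if_true, one_mul]
      rw [Finset.sum_eq_single (E.snk ℓ)]
      · simp only [if_true]
        rw [← neg_sub (θ (E.snk ℓ)) (θ i), Real.sin_neg]
        ring
      · intro j _ hj
        simp [Ne.symm hj]
      · simp
    · simp [hs]
  rw [h1, h2]
  ring

/-- FLOW FEASIBILITY, condition (ii) of Theorem 2: `Γ ≜ ‖diag({a_ij})⁻¹ξ‖_∞ < 1`, written
componentwise as `|ξ_ℓ| < a_ℓ` for every edge (equivalent for `a_ℓ > 0`): «the active power flow
along each edge be feasible, i.e., less than the physical maximum `a_ij = E_iE_j|Y_ij|`».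
[cite: SimpsonporcoDorflerBullo2013, §3 Theorem 2 (ii) eq. (DorflerCondition); Remark 3] -/
def FlowFeasible (ξ : Fin m → ℝ) : Prop := ∀ ℓ, |ξ ℓ| < E.w ℓ

end EdgeList

variable {m : ℕ} (E : EdgeList n m)

/-- KCL FLOW: `ξ ∈ ℝ^{|E|}` is a vector of edge power flows satisfying Kirchhoff's current law for
the steady-state injections, `P̃ = P* − ω_avg D 1_n = Bξ` («given implicitly by
`P* − ω_avg D 1_n = Bξ`»; unique when the network is acyclic, `ker B = ∅` — uniqueness not typed).
[cite: SimpsonporcoDorflerBullo2013, §3 Theorem 2 (statement); Remark 3] -/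
def IsKCLFlow (ξ : Fin m → ℝ) : Prop := ∀ i, N.shiftedInjection i = E.div ξ i

/-- The explicit synchronization-rate bound of statement (b):
`λ ≜ λ₂(L) / (max_{i∈V_I} D_i) · √(1 − Γ²)` as a function of the Laplacian's algebraic connectivity
`λ₂(L)`, the largest time constant and `Γ` (DEFINITION ONLY — the rate claim is not typed).
[cite: SimpsonporcoDorflerBullo2013, §3 Theorem 2 (b) eq. (Rate)] -/
def syncRateBound (lambda2 maxD Gamma : ℝ) : ℝ := lambda2 / maxD * Real.sqrt (1 - Gamma ^ 2)

omit N in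
/-- Private helper: `|sin x| ≤ sin γ` whenever `|x| ≤ γ ≤ π/2` (monotonicity of `sin` on
`[−π/2, π/2]`). [folklore] -/
private theorem abs_sin_le_sin_of_abs_le {x γ : ℝ} (hx : |x| ≤ γ) (hγ : γ ≤ Real.pi / 2) :
    |Real.sin x| ≤ Real.sin γ := by
  have hxlo : -(Real.pi / 2) ≤ x := by linarith [neg_abs_le x]
  have hxhi : x ≤ Real.pi / 2 := le_trans (le_abs_self x) (le_trans hx hγ)
  have hmono := Real.strictMonoOn_sin
  rw [abs_le]
  constructor
  · rw [← Real.sin_neg]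
    have hm : -γ ≤ x := by linarith [neg_abs_le x]
    exact hmono.monotoneOn ⟨by linarith, by linarith⟩ ⟨hxlo, hxhi⟩ hm
  · have hm : x ≤ γ := le_trans (le_abs_self x) hx
    exact hmono.monotoneOn ⟨hxlo, hxhi⟩ ⟨by linarith, hγ⟩ hm

/-- Edge flows of an angle array in `Δ_G(γ)`, `γ ≤ π/2`, are bounded by `a_ℓ sin γ`:
`|a_ℓ sin(θ_i − θ_j)| ≤ a_ℓ sin γ` (for `a_ℓ ≥ 0`) — the relation `Γ ≤ sin γ` of the proof.
[cite: SimpsonporcoDorflerBullo2013, §3, proof of Theorem 2 («`Γ ≤ sin(γ)`»)] -/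
theorem abs_edgeFlow_le {γ : ℝ} {θ : Fin n → ℝ} (hw : ∀ ℓ, 0 ≤ E.w ℓ) (hγ : γ ≤ Real.pi / 2)
    (hθ : E.InArc γ θ) (ℓ : Fin m) : |E.edgeFlow θ ℓ| ≤ E.w ℓ * Real.sin γ := by
  unfold EdgeList.edgeFlow
  rw [abs_mul, abs_of_nonneg (hw ℓ)]
  exact mul_le_mul_of_nonneg_left (abs_sin_le_sin_of_abs_le (hθ ℓ) hγ) (hw ℓ)

/-- THEOREM 2, NECESSITY HALF «(i) ⇒ (ii)» WITH STATEMENT (a), PROVED (any topology, not only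
acyclic): if `θ*` is an equilibrium of (Aux) — equivalently the angle array of a synchronized
solution, `isAuxEquilibrium_of_sync` — lying in `Δ_G(γ)` for some `γ ∈ [0, π/2[`, then the edge
flows `ξ = diag({a_ij}) sin(Bᵀθ*)` satisfy KCL `P̃ = Bξ` and are feasible, `|ξ_ℓ| ≤ a_ℓ sin γ < a_ℓ`
(`Γ ≤ sin γ < 1`).  Hypotheses: the edge list represents the network, `a_ℓ > 0`.
[cite: SimpsonporcoDorflerBullo2013, §3 Theorem 2 ((i) ⇒ (ii), (a)) and proof up to eq. (ReducedDorfler)] -/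
theorem kclFlow_and_flowFeasible_of_isAuxEquilibrium (hE : E.Represents N) (hw : ∀ ℓ, 0 < E.w ℓ)
    {γ : ℝ} (hγ : γ < Real.pi / 2) {θ : Fin n → ℝ} (hθ : E.InArc γ θ)
    (heq : N.IsAuxEquilibrium θ) :
    N.IsKCLFlow E (E.edgeFlow θ) ∧ E.FlowFeasible (E.edgeFlow θ) := by
  constructor
  · intro i
    rw [← heq i]
    exact E.injection_eq_div_edgeFlow hE θ i
  · intro ℓ
    have hγ0 : 0 ≤ γ := le_trans (abs_nonneg _) (hθ ℓ)
    have hsinγ : Real.sin γ < 1 := by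
      rw [← Real.sin_pi_div_two]
      exact Real.strictMonoOn_sin ⟨by linarith [Real.pi_pos], le_of_lt hγ⟩
        ⟨by linarith [Real.pi_pos], le_refl _⟩ hγ
    have h1 := abs_edgeFlow_le E (fun ℓ => le_of_lt (hw ℓ)) (le_of_lt hγ) hθ ℓ
    have h2 : E.w ℓ * Real.sin γ < E.w ℓ := by
      have := mul_lt_mul_of_pos_left hsinγ (hw ℓ)
      simpa using this
    exact lt_of_le_of_lt h1 h2

/-- THE ALGEBRAIC CONVERSE STEP, PROVED (any topology): if `ξ` is a KCL flow (`P̃ = Bξ`) and the angle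
array satisfies eq. (ReducedDorfler), `diag({a_ij})⁻¹ξ = sin(Bᵀθ)` — here multiplied out as
`a_ℓ sin((Bᵀθ)_ℓ) = ξ_ℓ` — then `θ` is an equilibrium of (Aux), i.e. the angle array of a synchronized
solution (`isSolutionAt_of_isAuxEquilibrium`).  On an acyclic network (`ker B = ∅`) these are ALL the
equilibria and (ReducedDorfler) is solvable edge by edge iff `Γ < 1`; that step is not typed.
NOTE (as printed): statement (a) of the arXiv source reads «`sin(Bᵀθ*) = diag({a_ij}) ξ`», while the
proof's eq. (ReducedDorfler) has `diag({a_ij})⁻¹ξ`; the latter (dimensionally consistent, `|sin| ≤ 1`)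
is what is typed here. [cite: SimpsonporcoDorflerBullo2013, §3, proof of Theorem 2, eqs. (Aux-2)–(ReducedDorfler)] -/
theorem isAuxEquilibrium_of_kclFlow (hE : E.Represents N) {ξ : Fin m → ℝ} (hξ : N.IsKCLFlow E ξ)
    {θ : Fin n → ℝ} (hsin : ∀ ℓ, E.w ℓ * Real.sin (E.diff θ ℓ) = ξ ℓ) : N.IsAuxEquilibrium θ := by
  intro i
  rw [E.injection_eq_div_edgeFlow hE θ i, hξ i]
  unfold EdgeList.div EdgeList.edgeFlow
  refine Finset.sum_congr rfl fun ℓ _ => ?_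
  rw [hsin ℓ]


/-! ## Theorem 2 layer, part 2: acyclic networks — tree solvability of `Bᵀθ = y`, uniqueness of
KCL flows (`ker B = ∅`), and the SUFFICIENCY/existence half «(ii) ⇒ (i)» of Theorem 2

[cite: SimpsonporcoDorflerBullo2013, §1 («`ker(B) = ∅` for acyclic graphs. In this case, for
every `x ∈ 1^⊥` … there exists a unique `ξ` satisfying KCL `x = Bξ`» [NB:97]) and §3 Theorem 2,
proof from eq. (ReducedDorfler) on («uniquely solvable for `θ* ∈ Δ(γ)` … if and only if
`Γ ≤ sin(γ)`»)].  Acyclicity of the edge list is encoded by an ATTACHMENT ORDER (each edge, in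
the listed order, brings one endpoint that no earlier edge touches) — every forest admits one
(discovery order of any traversal) and only forests do; this folklore equivalence itself is not
formalised, the order is the hypothesis. -/

namespace EdgeList

variable {m : ℕ} (E : EdgeList n m)

/-- ATTACHMENT (leaf-discovery) ORDER: `fresh ℓ` is an endpoint of edge `ℓ` (which is not a
self-loop) that is NOT an endpoint of any earlier edge `ℓ' < ℓ`.  An edge list admitting such a map
is a forest built by successively attaching a pendant vertex (or starting a new component) — our
encoding of the paper's standing hypothesis «acyclic graph» (folklore equivalence, not formalised).
[cite: SimpsonporcoDorflerBullo2013, §1 «Algebraic graph theory» («acyclic graphs»)] -/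
def IsAttachmentOrder (fresh : Fin m → Fin n) : Prop :=
  ∀ ℓ, ((fresh ℓ = E.snk ℓ ∨ fresh ℓ = E.src ℓ) ∧ E.src ℓ ≠ E.snk ℓ) ∧
    ∀ ℓ', ℓ' < ℓ → fresh ℓ ≠ E.src ℓ' ∧ fresh ℓ ≠ E.snk ℓ'

/-- THE NETWORK IS ACYCLIC: the oriented edge list admits an attachment order (⇔ the underlying
graph is a forest; for a connected microgrid, a tree — «acyclic interconnections of inverters and
loads», incl. the parallel/star topology of Fig. (InvNet)).
[cite: SimpsonporcoDorflerBullo2013, §1 («`ker(B) = ∅` for acyclic graphs»); §3 Theorem 2 («defined on an acyclic network»)] -/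
def Acyclic (G : EdgeList n m) : Prop := ∃ fresh : Fin m → Fin n, G.IsAttachmentOrder fresh

/-- TREE SOLVABILITY, PROVED: on an acyclic network every prescription of edge differences is
realised by some node potential, `∀ y ∃ x, Bᵀx = y` (surjectivity of `Bᵀ`, dual to `ker B = ∅`) —
the step that makes eq. (ReducedDorfler) «uniquely solvable for θ*» edge by edge.
[cite: SimpsonporcoDorflerBullo2013, §1 («`ker(B) = ∅` for acyclic graphs»); §3 proof of Theorem 2
(«the explicit equilibrium angles are then obtained from the n decoupled equations (ReducedDorfler)»)] -/
theorem exists_diff_eq (hA : E.Acyclic) (y : Fin m → ℝ) : ∃ x : Fin n → ℝ, ∀ ℓ, E.diff x ℓ = y ℓ := by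
  classical
  obtain ⟨fresh, hfresh⟩ := hA
  -- induction on a prefix of the edge list
  have key : ∀ k : ℕ, ∃ x : Fin n → ℝ, ∀ ℓ : Fin m, (ℓ : ℕ) < k → E.diff x ℓ = y ℓ := by
    intro k
    induction k with
    | zero => exact ⟨fun _ => 0, fun ℓ h => absurd h (Nat.not_lt_zero _)⟩
    | succ k ih =>
      obtain ⟨x, hx⟩ := ih
      by_cases hk : k < m
      · set L : Fin m := ⟨k, hk⟩ with hL
        obtain ⟨⟨hend, hloop⟩, hearly⟩ := hfresh L
        -- value to assign at the fresh endpoint of edge `L`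
        rcases hend with hs | hs
        · -- fresh endpoint is the sink: set x(snk) := x(src) + y
          refine ⟨Function.update x (E.snk L) (x (E.src L) + y L), fun ℓ hℓ => ?_⟩
          rcases Nat.lt_succ_iff_lt_or_eq.mp hℓ with hlt | heq
          · have h1 : E.src ℓ ≠ E.snk L := by rw [← hs]; exact (hearly ℓ hlt).1.symm
            have h2 : E.snk ℓ ≠ E.snk L := by rw [← hs]; exact (hearly ℓ hlt).2.symm
            unfold diff
            rw [Function.update_of_ne h1, Function.update_of_ne h2]
            exact hx ℓ hlt
          · have hℓL : ℓ = L := Fin.ext heq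
            subst hℓL
            unfold diff
            rw [Function.update_self, Function.update_of_ne hloop]
            ring
        · -- fresh endpoint is the source: set x(src) := x(snk) − y
          refine ⟨Function.update x (E.src L) (x (E.snk L) - y L), fun ℓ hℓ => ?_⟩
          rcases Nat.lt_succ_iff_lt_or_eq.mp hℓ with hlt | heq
          · have h1 : E.src ℓ ≠ E.src L := by rw [← hs]; exact (hearly ℓ hlt).1.symm
            have h2 : E.snk ℓ ≠ E.src L := by rw [← hs]; exact (hearly ℓ hlt).2.symm
            unfold diff
            rw [Function.update_of_ne h1, Function.update_of_ne h2]
            exact hx ℓ hlt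
          · have hℓL : ℓ = L := Fin.ext heq
            subst hℓL
            unfold diff
            rw [Function.update_self, Function.update_of_ne (Ne.symm hloop)]
            ring
      · -- no edge with index k: the prefix condition is unchanged
        exact ⟨x, fun ℓ hℓ => hx ℓ (lt_of_lt_of_le ℓ.isLt (not_lt.mp hk))⟩
  obtain ⟨x, hx⟩ := key m
  exact ⟨x, fun ℓ => hx ℓ ℓ.isLt⟩

/-- `ker B = ∅` ON AN ACYCLIC NETWORK, PROVED: edge flows with zero nodal balance vanish,
`Bξ = 0 ⇒ ξ = 0`. [cite: SimpsonporcoDorflerBullo2013, §1 («`ker(B) = ∅` for acyclic graphs»)] -/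
theorem eq_zero_of_div_eq_zero (hA : E.Acyclic) {ξ : Fin m → ℝ} (hξ : ∀ k, E.div ξ k = 0) :
    ∀ ℓ, ξ ℓ = 0 := by
  classical
  obtain ⟨fresh, hfresh⟩ := hA
  -- partial row sums over the prefix `ℓ < k`
  have key : ∀ k : ℕ, k ≤ m →
      (∀ i, ∑ ℓ : Fin m, (if (ℓ : ℕ) < k then E.inc i ℓ * ξ ℓ else 0) = 0) →
        ∀ ℓ : Fin m, (ℓ : ℕ) < k → ξ ℓ = 0 := by
    intro k
    induction k with
    | zero => intro _ _ ℓ h; exact absurd h (Nat.not_lt_zero _)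
    | succ k ih =>
      intro hkm hrow
      have hk : k < m := Nat.lt_of_succ_le hkm
      set L : Fin m := ⟨k, hk⟩ with hL
      obtain ⟨⟨hend, hloop⟩, hearly⟩ := hfresh L
      -- split the prefix sum `ℓ < k+1` into `ℓ < k` plus the term `ℓ = L`
      have hsplit : ∀ i, ∑ ℓ : Fin m, (if (ℓ : ℕ) < k + 1 then E.inc i ℓ * ξ ℓ else 0)
          = (∑ ℓ : Fin m, (if (ℓ : ℕ) < k then E.inc i ℓ * ξ ℓ else 0)) + E.inc i L * ξ L := by
        intro i
        have hpt : ∀ ℓ : Fin m, (if (ℓ : ℕ) < k + 1 then E.inc i ℓ * ξ ℓ else 0)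
            = (if (ℓ : ℕ) < k then E.inc i ℓ * ξ ℓ else 0) + (if ℓ = L then E.inc i ℓ * ξ ℓ else 0) := by
          intro ℓ
          by_cases h1 : (ℓ : ℕ) < k
          · have h2 : ℓ ≠ L := by intro h; rw [h] at h1; exact lt_irrefl _ h1
            have h3 : (ℓ : ℕ) < k + 1 := Nat.lt_succ_of_lt h1
            simp [h1, h2, h3]
          · by_cases h2 : ℓ = L
            · rw [h2]; simp [hL]
            · have h3 : ¬ (ℓ : ℕ) < k + 1 := by
                intro h
                rcases Nat.lt_succ_iff_lt_or_eq.mp h with h' | h'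
                · exact h1 h'
                · exact h2 (Fin.ext h')
              simp [h1, h2, h3]
        simp_rw [hpt, Finset.sum_add_distrib, Finset.sum_ite_eq', Finset.mem_univ, if_true]
      -- the row of the fresh vertex of `L`: earlier edges do not touch it
      have hrowL : ∑ ℓ : Fin m, (if (ℓ : ℕ) < k then E.inc (fresh L) ℓ * ξ ℓ else 0) = 0 := by
        refine Finset.sum_eq_zero fun ℓ _ => ?_
        by_cases h1 : (ℓ : ℕ) < k
        · have hne := hearly ℓ h1
          have : E.inc (fresh L) ℓ = 0 := by
            unfold inc
            rw [if_neg (Ne.symm hne.2), if_neg (Ne.symm hne.1), sub_zero]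
          simp [h1, this]
        · simp [h1]
      have hincL : E.inc (fresh L) L = 1 ∨ E.inc (fresh L) L = -1 := by
        unfold inc
        rcases hend with hs | hs
        · left; rw [if_pos hs.symm, if_neg (by rw [hs]; exact hloop)]; ring
        · right; rw [if_neg (by rw [hs]; exact Ne.symm hloop), if_pos hs.symm]; ring
      have hξL : ξ L = 0 := by
        have h := hrow (fresh L)
        rw [hsplit, hrowL, zero_add] at h
        rcases hincL with h1 | h1 <;> rw [h1] at h <;> linarith
      -- remaining prefix
      have hrow' : ∀ i, ∑ ℓ : Fin m, (if (ℓ : ℕ) < k then E.inc i ℓ * ξ ℓ else 0) = 0 := by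
        intro i
        have h := hrow i
        rw [hsplit, hξL, mul_zero, add_zero] at h
        exact h
      intro ℓ hℓ
      rcases Nat.lt_succ_iff_lt_or_eq.mp hℓ with hlt | heq
      · exact ih (le_of_lt hk) hrow' ℓ hlt
      · have : ℓ = L := Fin.ext heq
        rw [this]; exact hξL
  have hfull : ∀ i, ∑ ℓ : Fin m, (if (ℓ : ℕ) < m then E.inc i ℓ * ξ ℓ else 0) = 0 := by
    intro i
    rw [← hξ i]
    unfold div
    exact Finset.sum_congr rfl fun ℓ _ => by simp [ℓ.isLt]
  intro ℓ
  exact key m le_rfl hfull ℓ ℓ.isLt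

/-- UNIQUENESS OF KCL FLOWS on an acyclic network, PROVED: `Bξ = Bξ' ⇒ ξ = ξ'` — «there exists a
unique `ξ ∈ ℝ^{|E|}` satisfying Kirchoff's Current Law (KCL) `x = Bξ`».
[cite: SimpsonporcoDorflerBullo2013, §1 «Algebraic graph theory»; §3 Theorem 2 («the unique vector of
edge power flows satisfying KCL»)] -/
theorem div_injective (hA : E.Acyclic) {ξ ξ' : Fin m → ℝ} (h : ∀ k, E.div ξ k = E.div ξ' k) :
    ξ = ξ' := by
  have hz : ∀ k, E.div (fun ℓ => ξ ℓ - ξ' ℓ) k = 0 := by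
    intro k
    have := h k
    unfold div at this ⊢
    simp only [mul_sub, Finset.sum_sub_distrib]
    linarith
  funext ℓ
  have := E.eq_zero_of_div_eq_zero hA hz ℓ
  linarith

end EdgeList

/-- THEOREM 2, SUFFICIENCY HALF «(ii) ⇒ (i)» (existence part), PROVED: on an ACYCLIC network
represented by the edge list, with `a_ℓ > 0`, if the KCL flow `ξ` (`P̃ = Bξ`) is feasible
(`|ξ_ℓ| < a_ℓ`, i.e. `Γ < 1`), then the angle array `θ*` with `Bᵀθ* = arcsin(diag({a_ij})⁻¹ξ)`
exists (tree solvability) and is an equilibrium of (Aux) — hence `t ↦ θ* + ω_avg t 1_n` is a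
synchronized solution (`isSolutionAt_of_isAuxEquilibrium`) — with every edge difference
`|θ*_i − θ*_j| = |arcsin(ξ_ℓ/a_ℓ)| < π/2`.  NOT covered here: local exponential stability
(all-inverter networks: `DroopSyncExponentialStability.lean`) and the rate (b).
[cite: SimpsonporcoDorflerBullo2013, §3 Theorem 2 ((ii) ⇒ (i), (a)) and proof from eq. (ReducedDorfler)] -/
theorem exists_isAuxEquilibrium_of_flowFeasible (hE : E.Represents N) (hA : E.Acyclic)
    (hw : ∀ ℓ, 0 < E.w ℓ) {ξ : Fin m → ℝ} (hξ : N.IsKCLFlow E ξ) (hF : E.FlowFeasible ξ) :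
    ∃ θ : Fin n → ℝ, N.IsAuxEquilibrium θ ∧ ∀ ℓ, |E.diff θ ℓ| < Real.pi / 2 := by
  obtain ⟨θ, hθ⟩ := E.exists_diff_eq hA (fun ℓ => Real.arcsin (ξ ℓ / E.w ℓ))
  have hratio : ∀ ℓ, -1 < ξ ℓ / E.w ℓ ∧ ξ ℓ / E.w ℓ < 1 := by
    intro ℓ
    have h := abs_lt.mp (hF ℓ)
    constructor
    · rw [lt_div_iff₀ (hw ℓ)]; linarith
    · rw [div_lt_iff₀ (hw ℓ)]; linarith
  refine ⟨θ, ?_, ?_⟩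
  · refine N.isAuxEquilibrium_of_kclFlow E hE hξ (θ := θ) fun ℓ => ?_
    rw [hθ ℓ, Real.sin_arcsin (le_of_lt (hratio ℓ).1) (le_of_lt (hratio ℓ).2)]
    rw [mul_div_assoc', mul_div_cancel_left₀ _ (ne_of_gt (hw ℓ))]
  · intro ℓ
    rw [hθ ℓ, abs_lt]
    exact ⟨Real.neg_pi_div_two_lt_arcsin.mpr (hratio ℓ).1,
      Real.arcsin_lt_pi_div_two.mpr (hratio ℓ).2⟩

/-- THEOREM 2, (i) ⇔ (ii) AT THE LEVEL OF SYNCHRONIZED SOLUTIONS, PROVED (acyclic network, edge list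
representing the nodal data, `a_ℓ > 0`, `ξ` = the KCL flow): the power flow is feasible, `Γ < 1`,
IF AND ONLY IF there exist an arc length `γ ∈ [0, π/2[` and an equilibrium `θ*` of (Aux) (= the
angle array of a synchronized solution, `isSolutionAt_of_isAuxEquilibrium` /
`isAuxEquilibrium_of_sync`) with `θ* ∈ Δ_G(γ)`.  The «locally exponentially stable and unique» part
of statement (i) is NOT included here; for all-inverter networks (`D_i > 0` everywhere, connected
coupling graph) it is `DroopNetwork.flowFeasible_iff_exists_unique_expStable_sync`
(`DroopSyncExponentialStability.lean` §7). [cite: SimpsonporcoDorflerBullo2013, §3 Theorem 2 ((i) ⇔ (ii))] -/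
theorem flowFeasible_iff_exists_isAuxEquilibrium (hE : E.Represents N) (hA : E.Acyclic)
    (hw : ∀ ℓ, 0 < E.w ℓ) {ξ : Fin m → ℝ} (hξ : N.IsKCLFlow E ξ) :
    E.FlowFeasible ξ ↔
      ∃ γ : ℝ, 0 ≤ γ ∧ γ < Real.pi / 2 ∧ ∃ θ : Fin n → ℝ, E.InArc γ θ ∧ N.IsAuxEquilibrium θ := by
  constructor
  · intro hF
    obtain ⟨θ, hθ, harc⟩ := N.exists_isAuxEquilibrium_of_flowFeasible E hE hA hw hξ hF
    -- γ := the largest edge difference (0 when there are no edges)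
    rcases Nat.eq_zero_or_pos m with hm | hm
    · subst hm
      exact ⟨0, le_rfl, by linarith [Real.pi_pos], θ, fun ℓ => ℓ.elim0, hθ⟩
    · haveI : Nonempty (Fin m) := ⟨⟨0, hm⟩⟩
      obtain ⟨ℓ0, hℓ0⟩ := Finite.exists_max (fun ℓ => |E.diff θ ℓ|)
      exact ⟨|E.diff θ ℓ0|, abs_nonneg _, harc ℓ0, θ, fun ℓ => hℓ0 ℓ, hθ⟩
  · rintro ⟨γ, _, hγ, θ, harc, hθ⟩
    obtain ⟨hkcl, hfeas⟩ := N.kclFlow_and_flowFeasible_of_isAuxEquilibrium E hE hw hγ harc hθ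
    -- both `ξ` and the edge flows of `θ` are KCL flows; on an acyclic network they coincide
    have heq : E.edgeFlow θ = ξ :=
      E.div_injective hA fun k => by rw [← hkcl k, ← hξ k]
    rw [← heq]
    exact hfeas

/-! ## §4 Power sharing and actuation constraints (Definition 6, Theorem 7) — append 2026-08-27

[cite: SimpsonporcoDorflerBullo2013, §4 Definition 6 and Theorem 7 with its proof (arXiv:1206.5033,
held LaTeX source p0011 L10–L61)]:

> Definition 6 (Proportional Droop Coefficients). «The droop coefficients are selected proportionally
> if P_i*/D_i = P_j*/D_j and P_i*/P̄_i = P_j*/P̄_j for all i,j ∈ V_I.»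
> Theorem 7 (Power Flow Constraints and Power Sharing). «Consider a synchronized solution of the
> frequency-droop controlled system (KuraDroop)–(PowerBal), and let the droop coefficients be selected
> proportionally. Define the total load P_L ≜ Σ_{i∈V_L} P_i*. The following two statements are
> equivalent: (i) Injection Constraints: 0 ≤ P_e,i ≤ P̄_i ∀ i ∈ V_I; (ii) Load Constraint:
> −Σ_{j∈V_I} P̄_j ≤ P_L ≤ 0. Moreover, the inverters share the total load P_L proportionally according
> to their power ratings, that is, P_e,i/P̄_i = P_e,j/P̄_j, for each i,j ∈ V_I.»
> Proof: «the steady state active power injection at each inverter is given by P_e,i = P_i* − ω_sync D_i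
> … substituting the expression for ω_sync …».

Here: every node is an inverter (`D_i > 0`) or a load (`D_i = 0`) — hypothesis `0 ≤ D_i`; at least one
inverter (`Σ D_i > 0`); the steady-state injection of a synchronized solution is the tree's
`shiftedInjection i = P_i* − ω_avg D_i` (`isAuxEquilibrium_of_sync`, `syncFrequency_eq_avgFrequency`);
proportionality is carried cross-multiplied (no divisions), with `P_i* > 0` on `V_I` (the printed ratios
`P̄_i/P_i*`). The KEY IDENTITY behind the printed computation: `P_e,i = −P_L·D_i/Σ_j D_j` on `V_I`. -/

/-- **Definition 6 (proportional droop coefficients)**, cross-multiplied: on inverter nodes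
`P_i* D_j = P_j* D_i` and `P_i* P̄_j = P_j* P̄_i` (`P̄` = the power ratings).
[cite: SimpsonporcoDorflerBullo2013, §4 Definition 6] -/
def ProportionalDroop (Pbar : Fin n → ℝ) : Prop :=
  ∀ i j, N.IsInverterNode i → N.IsInverterNode j →
    N.Pstar i * N.Dc j = N.Pstar j * N.Dc i ∧ N.Pstar i * Pbar j = N.Pstar j * Pbar i

/-- The total load `P_L ≜ Σ_{i ∈ V_L} P_i*` (load nodes = `D_i = 0`).
[cite: SimpsonporcoDorflerBullo2013, §4 Theorem 7] -/
def totalLoad : ℝ := ∑ i, if N.Dc i = 0 then N.Pstar i else 0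

/-- The total rating `Σ_{j ∈ V_I} P̄_j` of the inverter nodes. [cite: SimpsonporcoDorflerBullo2013, §4
Theorem 7 (ii)] -/
def totalRating (Pbar : Fin n → ℝ) : ℝ := ∑ i, if N.Dc i = 0 then 0 else Pbar i

/-- With nonnegative time constants a node that is not a load is an inverter. [cite:
SimpsonporcoDorflerBullo2013, §3 («D = diag(0_{|V_L|}, {D_i}_{i∈V_I})»)] -/
theorem isInverterNode_of_ne (hD : ∀ i, 0 ≤ N.Dc i) {j : Fin n} (hj : N.Dc j ≠ 0) :
    N.IsInverterNode j :=
  lt_of_le_of_ne (hD j) (Ne.symm hj)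

/-- «Substituting the expression for ω_sync»: under proportional coefficients the nominal injections
sum to `Σ_j P_j* = P_L + (P_i*/D_i)·Σ_j D_j` for any inverter `i`.
[cite: SimpsonporcoDorflerBullo2013, §4, proof of Theorem 7] -/
theorem sum_Pstar_eq_of_proportional (hD : ∀ i, 0 ≤ N.Dc i) {Pbar : Fin n → ℝ}
    (hp : N.ProportionalDroop Pbar) {i : Fin n} (hi : N.IsInverterNode i) :
    ∑ j, N.Pstar j = N.totalLoad + N.Pstar i / N.Dc i * ∑ j, N.Dc j := by
  have hDi : N.Dc i ≠ 0 := ne_of_gt hi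
  rw [totalLoad, Finset.mul_sum, ← Finset.sum_add_distrib]
  refine Finset.sum_congr rfl fun j _ => ?_
  by_cases hj : N.Dc j = 0
  · simp [hj]
  · obtain ⟨h1, -⟩ := hp i j hi (N.isInverterNode_of_ne hD hj)
    rw [if_neg hj, zero_add]
    field_simp
    linarith

/-- **THE KEY IDENTITY: `P_e,i = −P_L·D_i/Σ_j D_j` at every inverter node** under proportional
coefficients — the inverters pick up the total load in proportion to their time constants.
[cite: SimpsonporcoDorflerBullo2013, §4, proof of Theorem 7 («P_e,i = P_i* − ω_sync D_i»)] -/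
theorem shiftedInjection_eq_of_proportional (hD : ∀ i, 0 ≤ N.Dc i) (hS : 0 < ∑ i, N.Dc i)
    {Pbar : Fin n → ℝ} (hp : N.ProportionalDroop Pbar) {i : Fin n} (hi : N.IsInverterNode i) :
    N.shiftedInjection i = -N.totalLoad * N.Dc i / ∑ j, N.Dc j := by
  have hDi : N.Dc i ≠ 0 := ne_of_gt hi
  rw [shiftedInjection, avgFrequency, N.sum_Pstar_eq_of_proportional hD hp hi]
  field_simp
  ring

/-- Under proportional coefficients the ratings are proportional to the time constants on `V_I`:
`P̄_j D_i = P̄_i D_j` (`P_i* > 0` on `V_I`). [cite: SimpsonporcoDorflerBullo2013, §4 Definition 6] -/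
theorem rating_mul_Dc_eq (hP : ∀ j, N.IsInverterNode j → 0 < N.Pstar j) {Pbar : Fin n → ℝ}
    (hp : N.ProportionalDroop Pbar) {i j : Fin n} (hi : N.IsInverterNode i) (hj : N.IsInverterNode j) :
    Pbar j * N.Dc i = Pbar i * N.Dc j := by
  obtain ⟨h1, h2⟩ := hp i j hi hj
  have hPi := hP i hi
  have hPj := hP j hj
  -- `P̄_j = P_j* P̄_i / P_i*`, `D_j = P_j* D_i / P_i*`
  have e1 : Pbar j = N.Pstar j * Pbar i / N.Pstar i := by
    field_simp; linarith
  have e2 : N.Dc j = N.Pstar j * N.Dc i / N.Pstar i := by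
    field_simp; linarith
  rw [e1, e2]
  field_simp

/-- The total rating in terms of one inverter: `Σ_{V_I} P̄_j = (P̄_i/D_i)·Σ_j D_j`.
[cite: SimpsonporcoDorflerBullo2013, §4, proof of Theorem 7 («−(P̄_i/P_i*)Σ_j P_j* = −Σ_j P̄_j»)] -/
theorem totalRating_eq (hD : ∀ i, 0 ≤ N.Dc i) (hP : ∀ j, N.IsInverterNode j → 0 < N.Pstar j)
    {Pbar : Fin n → ℝ} (hp : N.ProportionalDroop Pbar) {i : Fin n} (hi : N.IsInverterNode i) :
    N.totalRating Pbar = Pbar i / N.Dc i * ∑ j, N.Dc j := by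
  have hDi : N.Dc i ≠ 0 := ne_of_gt hi
  rw [totalRating, Finset.mul_sum]
  refine Finset.sum_congr rfl fun j _ => ?_
  by_cases hj : N.Dc j = 0
  · simp [hj]
  · rw [if_neg hj]
    have := N.rating_mul_Dc_eq hP hp hi (N.isInverterNode_of_ne hD hj)
    field_simp
    linarith

/-- **Theorem 7, lower constraint**: at an inverter node `0 ≤ P_e,i ↔ P_L ≤ 0`.
[cite: SimpsonporcoDorflerBullo2013, §4 Theorem 7 (proof, first equivalence)] -/
theorem shiftedInjection_nonneg_iff (hD : ∀ i, 0 ≤ N.Dc i) (hS : 0 < ∑ i, N.Dc i)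
    {Pbar : Fin n → ℝ} (hp : N.ProportionalDroop Pbar) {i : Fin n} (hi : N.IsInverterNode i) :
    0 ≤ N.shiftedInjection i ↔ N.totalLoad ≤ 0 := by
  rw [N.shiftedInjection_eq_of_proportional hD hS hp hi]
  have hDi : 0 < N.Dc i := hi
  rw [le_div_iff₀ hS, zero_mul]
  constructor
  · intro h; nlinarith
  · intro h; nlinarith

/-- **Theorem 7, upper constraint**: at an inverter node `P_e,i ≤ P̄_i ↔ −Σ_{V_I} P̄_j ≤ P_L`
(`P_j* > 0` on `V_I`). [cite: SimpsonporcoDorflerBullo2013, §4 Theorem 7 (proof, second equivalence)] -/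
theorem shiftedInjection_le_rating_iff (hD : ∀ i, 0 ≤ N.Dc i) (hS : 0 < ∑ i, N.Dc i)
    (hP : ∀ j, N.IsInverterNode j → 0 < N.Pstar j) {Pbar : Fin n → ℝ} (hp : N.ProportionalDroop Pbar)
    {i : Fin n} (hi : N.IsInverterNode i) :
    N.shiftedInjection i ≤ Pbar i ↔ -N.totalRating Pbar ≤ N.totalLoad := by
  rw [N.shiftedInjection_eq_of_proportional hD hS hp hi, N.totalRating_eq hD hP hp hi]
  have hDi : 0 < N.Dc i := hi
  rw [div_le_iff₀ hS]
  constructor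
  · intro h
    have : -(Pbar i / N.Dc i * ∑ j, N.Dc j) * N.Dc i ≤ N.totalLoad * N.Dc i := by
      have e : -(Pbar i / N.Dc i * ∑ j, N.Dc j) * N.Dc i = -(Pbar i * ∑ j, N.Dc j) := by
        field_simp
      rw [e]; nlinarith
    exact le_of_mul_le_mul_right this hDi
  · intro h
    have := mul_le_mul_of_nonneg_right h hDi.le
    have e : -(Pbar i / N.Dc i * ∑ j, N.Dc j) * N.Dc i = -(Pbar i * ∑ j, N.Dc j) := by
      field_simp
    rw [e] at this
    nlinarith

/-- **Theorem 7, proportional power sharing**: `P_e,i/P̄_i = P_e,j/P̄_j` on `V_I`, cross-multiplied: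
`P_e,i P̄_j = P_e,j P̄_i`. [cite: SimpsonporcoDorflerBullo2013, §4 Theorem 7 («the inverters share the
total load P_L proportionally according to their power ratings»)] -/
theorem powerSharing (hD : ∀ i, 0 ≤ N.Dc i) (hS : 0 < ∑ i, N.Dc i)
    (hP : ∀ j, N.IsInverterNode j → 0 < N.Pstar j) {Pbar : Fin n → ℝ} (hp : N.ProportionalDroop Pbar)
    {i j : Fin n} (hi : N.IsInverterNode i) (hj : N.IsInverterNode j) :
    N.shiftedInjection i * Pbar j = N.shiftedInjection j * Pbar i := by
  rw [N.shiftedInjection_eq_of_proportional hD hS hp hi, N.shiftedInjection_eq_of_proportional hD hS hp hj]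
  have h := N.rating_mul_Dc_eq hP hp hi hj
  have hS' : (∑ k, N.Dc k) ≠ 0 := hS.ne'
  field_simp
  linear_combination (-N.totalLoad) * h

/-- **Theorem 7 (Power Flow Constraints and Power Sharing), (i) ⇔ (ii)**: with nonnegative time
constants, at least one inverter, positive nominal injections on `V_I` and proportionally selected
coefficients, the steady-state injections of a synchronized solution satisfy `0 ≤ P_e,i ≤ P̄_i` at
EVERY inverter iff the total load satisfies `−Σ_{V_I} P̄_j ≤ P_L ≤ 0`.
[cite: SimpsonporcoDorflerBullo2013, §4 Theorem 7] MODELLED: lossless droop microgrid model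
(KuraDroop)–(PowerBal); `P_e,i` = the tree's `shiftedInjection i` at a synchronized solution. -/
theorem injectionConstraints_iff_loadConstraint (hD : ∀ i, 0 ≤ N.Dc i) (hS : 0 < ∑ i, N.Dc i)
    (hP : ∀ j, N.IsInverterNode j → 0 < N.Pstar j) {Pbar : Fin n → ℝ} (hp : N.ProportionalDroop Pbar) :
    (∀ i, N.IsInverterNode i → 0 ≤ N.shiftedInjection i ∧ N.shiftedInjection i ≤ Pbar i) ↔
      (-N.totalRating Pbar ≤ N.totalLoad ∧ N.totalLoad ≤ 0) := by
  -- there is an inverter node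
  obtain ⟨i₀, hi₀⟩ : ∃ i, N.IsInverterNode i := by
    by_contra hne
    have : ∑ i, N.Dc i ≤ 0 :=
      Finset.sum_nonpos fun i _ => not_lt.1 fun h => hne ⟨i, h⟩
    linarith
  constructor
  · intro h
    obtain ⟨h0, h1⟩ := h i₀ hi₀
    exact ⟨(N.shiftedInjection_le_rating_iff hD hS hP hp hi₀).1 h1,
      (N.shiftedInjection_nonneg_iff hD hS hp hi₀).1 h0⟩
  · rintro ⟨hlo, hhi⟩ i hi
    exact ⟨(N.shiftedInjection_nonneg_iff hD hS hp hi).2 hhi,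
      (N.shiftedInjection_le_rating_iff hD hS hP hp hi).2 hlo⟩

/-- Theorem 7 read AT a synchronized solution of (KuraDroop)–(PowerBal) (symmetric `|Y|`): the active
power injections `P_e,i(θ(t))` themselves obey the key identity, hence all of the above.
[cite: SimpsonporcoDorflerBullo2013, §4 Theorem 7 («Consider a synchronized solution …»)] -/
theorem injection_eq_of_sync_of_proportional (hY : ∀ i j, N.Yabs i j = N.Yabs j i)
    (hD : ∀ i, 0 ≤ N.Dc i) (hS : 0 < ∑ i, N.Dc i) {Pbar : Fin n → ℝ} (hp : N.ProportionalDroop Pbar)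
    {θ : ℝ → Fin n → ℝ} {t ωsync : ℝ} (hsol : N.IsSolutionAt θ t)
    (hsync : ∀ i, HasDerivAt (fun s => θ s i) ωsync t) {i : Fin n} (hi : N.IsInverterNode i) :
    N.injection (θ t) i = -N.totalLoad * N.Dc i / ∑ j, N.Dc j := by
  rw [N.isAuxEquilibrium_of_sync hY hS.ne' hsol hsync i]
  exact N.shiftedInjection_eq_of_proportional hD hS hp hi

/-! ## §5 Secondary control: equilibria of the DAPI closed loop (Theorem 8, algebraic part) —
append 2026-08-27

[cite: SimpsonporcoDorflerBullo2013, §5 eqs. (primary control)–(secondary control), the closed loop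
(load/primary/secondary – closed loop) and Theorem 8 (arXiv:1206.5033 p0012 L20–L67)]:

> closed loop: `0 = P_i* − Σ_j a_ij sin(θ_i − θ_j)` (i ∈ V_L); `D_i θ̇_i = P_i* − p_i − Σ_j a_ij sin(θ_i − θ_j)`
> (i ∈ V_I); `k_i ṗ_i = P_i* − p_i − Σ_j a_ij sin(θ_i − θ_j) − Σ_{j∈V_I} L_c,ij (p_i/D_i − p_j/D_j)`
> (i ∈ V_I), `L_c` «the Laplacian matrix corresponding to a weighted, undirected and connected
> communication graph between the inverters».
> Theorem 8: «… (ii) … a locally exponentially stable and unique equilibrium (θ*, p*) … If the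
> equivalent statements (i) and (ii) hold true, then the unique equilibrium is given as in Theorem 2
> (ii), along with p_i* = D_i ω_avg for i ∈ V_I. Moreover, if the droop coefficients are selected
> proportionally, then the DAPI controller preserves the proportional power sharing property of the
> primary droop controller.»

Typed here (the ALGEBRAIC content; the local exponential stability of Theorem 8 is a linearisation
statement and is NOT typed): the rest points `(θ*, p*)` of the DAPI closed loop — rest points in the
ORIGINAL frame, `θ̇ = 0`: the secondary layer removes the frequency deviation `ω_avg` — are exactly the
(Aux)-equilibria of Theorem 2 together with `p_i* = D_i ω_avg` on `V_I`, provided the communication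
graph among the inverters is connected (carried as the kernel property of its Laplacian action:
`CommConnected`); and at such a rest point the injections are the droop steady-state injections
`P_i* − ω_avg D_i`, so Theorem 7's proportional sharing is preserved verbatim. -/

/-- Connectivity of the inverter communication graph with weights `A_c`, as the kernel property of its
Laplacian action on `V_I`: a vector whose weighted differences vanish at every inverter is constant on
the inverters. [cite: SimpsonporcoDorflerBullo2013, §5 («connected communication Laplacian L_c»)] -/
def CommConnected (Ac : Fin n → Fin n → ℝ) : Prop :=
  ∀ x : Fin n → ℝ, (∀ i, N.IsInverterNode i → ∑ j, Ac i j * (x i - x j) = 0) →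
    ∀ i j, N.IsInverterNode i → N.IsInverterNode j → x i = x j

/-- **Rest points of the DAPI closed loop** (load/primary/secondary – closed loop) with `θ̇ = 0`,
`ṗ = 0`: power balance at the loads, `P_i* − p_i − P_e,i(θ) = 0` at the inverters, and the secondary
equation with the communication term `Σ_j A_c,ij (p_i/D_i − p_j/D_j)`.
[cite: SimpsonporcoDorflerBullo2013, §5 eqs. (load – closed loop)–(secondary control – closed loop)] -/
def IsDAPIEquilibrium (Ac : Fin n → Fin n → ℝ) (θ p : Fin n → ℝ) : Prop :=
  (∀ i, N.IsLoadNode i → N.injection θ i = N.Pstar i) ∧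
  (∀ i, N.IsInverterNode i → N.Pstar i - p i - N.injection θ i = 0) ∧
  (∀ i, N.IsInverterNode i →
    N.Pstar i - p i - N.injection θ i - ∑ j, Ac i j * (p i / N.Dc i - p j / N.Dc j) = 0)

/-- **Theorem 8, the equilibrium «given as in Theorem 2 (ii), along with p_i* = D_i ω_avg»**: for
symmetric `|Y|`, nonnegative time constants with at least one inverter and a connected communication
graph among the inverters (no weights towards load nodes), `(θ, p)` is a rest point of the DAPI closed loop iff `θ` is an (Aux)-equilibrium of Theorem 2 and
`p_i = D_i ω_avg` at every inverter. [cite: SimpsonporcoDorflerBullo2013, §5 Theorem 8] MODELLED: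
lossless droop microgrid with DAPI secondary control; local exponential stability NOT typed. -/
theorem isDAPIEquilibrium_iff (hY : ∀ i j, N.Yabs i j = N.Yabs j i) (hD : ∀ i, 0 ≤ N.Dc i)
    (hS : 0 < ∑ i, N.Dc i) {Ac : Fin n → Fin n → ℝ} (hAc : ∀ i j, N.IsLoadNode j → Ac i j = 0)
    (hconn : N.CommConnected Ac) (θ p : Fin n → ℝ) :
    N.IsDAPIEquilibrium Ac θ p ↔
      N.IsAuxEquilibrium θ ∧ ∀ i, N.IsInverterNode i → p i = N.Dc i * N.avgFrequency := by
  constructor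
  · rintro ⟨hL, hI, hI2⟩
    -- the communication term vanishes at every inverter, so `p/D` is constant on `V_I`
    have hcomm : ∀ i, N.IsInverterNode i → ∑ j, Ac i j * (p i / N.Dc i - p j / N.Dc j) = 0 := by
      intro i hi
      have h1 := hI i hi
      have h2 := hI2 i hi
      linarith
    have hconst := hconn (fun i => p i / N.Dc i) hcomm
    -- summing the balance equations over all nodes: `Σ P* = Σ_{V_I} p`
    have hnode : ∀ i, N.Pstar i - N.injection θ i = (if N.Dc i = 0 then 0 else p i) := by
      intro i
      by_cases hi : N.Dc i = 0
      · rw [if_pos hi, hL i hi, sub_self]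
      · rw [if_neg hi]
        have := hI i (N.isInverterNode_of_ne hD hi)
        linarith
    have hsum : ∑ i, N.Pstar i = ∑ i, (if N.Dc i = 0 then 0 else p i) := by
      have := Finset.sum_congr rfl fun i (_ : i ∈ Finset.univ) => hnode i
      rw [Finset.sum_sub_distrib, N.sum_injection_eq_zero hY, sub_zero] at this
      exact this
    -- pick an inverter `i₀` and the common value `c = p_{i₀}/D_{i₀}`
    obtain ⟨i₀, hi₀⟩ : ∃ i, N.IsInverterNode i := by
      by_contra hne
      have : ∑ i, N.Dc i ≤ 0 :=
        Finset.sum_nonpos fun i _ => not_lt.1 fun h => hne ⟨i, h⟩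
      linarith
    set c := p i₀ / N.Dc i₀ with hc
    have hp : ∀ i, N.IsInverterNode i → p i = c * N.Dc i := by
      intro i hi
      have h : p i / N.Dc i = p i₀ / N.Dc i₀ := hconst i i₀ hi hi₀
      have hDi : N.Dc i ≠ 0 := ne_of_gt hi
      rw [hc, ← h, div_mul_cancel₀ _ hDi]
    have hsum' : ∑ i, N.Pstar i = c * ∑ i, N.Dc i := by
      rw [hsum, Finset.mul_sum]
      refine Finset.sum_congr rfl fun i _ => ?_
      by_cases hi : N.Dc i = 0
      · simp [hi]
      · rw [if_neg hi, hp i (N.isInverterNode_of_ne hD hi)]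
    have hcavg : c = N.avgFrequency := by
      rw [avgFrequency, hsum', mul_div_assoc, div_self hS.ne', mul_one]
    refine ⟨fun i => ?_, fun i hi => by rw [hp i hi, hcavg, mul_comm]⟩
    -- (Aux)-equilibrium at every node
    by_cases hi : N.Dc i = 0
    · rw [shiftedInjection, hi, mul_zero, sub_zero]
      exact hL i hi
    · have hI' := hI i (N.isInverterNode_of_ne hD hi)
      rw [hp i (N.isInverterNode_of_ne hD hi), hcavg] at hI'
      rw [shiftedInjection]
      linarith
  · rintro ⟨haux, hp⟩
    have hx : ∀ i, N.IsInverterNode i → p i / N.Dc i = N.avgFrequency := by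
      intro i hi
      rw [hp i hi]
      have hDi : N.Dc i ≠ 0 := ne_of_gt hi
      field_simp
    refine ⟨fun i hi => ?_, fun i hi => ?_, fun i hi => ?_⟩
    · rw [haux i, shiftedInjection, hi, mul_zero, sub_zero]
    · rw [haux i, hp i hi, shiftedInjection]; ring
    · -- the communication term vanishes: `p_j/D_j = ω_avg` on `V_I`, no weights towards loads
      have hz : ∑ j, Ac i j * (p i / N.Dc i - p j / N.Dc j) = 0 := by
        refine Finset.sum_eq_zero fun j _ => ?_
        by_cases hj : N.Dc j = 0
        · rw [hAc i j hj, zero_mul]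
        · rw [hx i hi, hx j (N.isInverterNode_of_ne hD hj), sub_self, mul_zero]
      rw [hz, haux i, hp i hi, shiftedInjection]
      ring

/-- **Theorem 8, «the DAPI controller preserves the proportional power sharing property»**: at a rest
point of the DAPI closed loop the injections are the droop steady-state injections `P_i* − ω_avg D_i`,
so under proportional coefficients `P_e,i P̄_j = P_e,j P̄_i` on `V_I` (Theorem 7).
[cite: SimpsonporcoDorflerBullo2013, §5 Theorem 8 (last sentence) with §4 Theorem 7] -/
theorem dapi_powerSharing (hY : ∀ i j, N.Yabs i j = N.Yabs j i) (hD : ∀ i, 0 ≤ N.Dc i)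
    (hS : 0 < ∑ i, N.Dc i) (hP : ∀ j, N.IsInverterNode j → 0 < N.Pstar j) {Pbar : Fin n → ℝ}
    (hprop : N.ProportionalDroop Pbar) {Ac : Fin n → Fin n → ℝ}
    (hAc : ∀ i j, N.IsLoadNode j → Ac i j = 0) (hconn : N.CommConnected Ac) {θ p : Fin n → ℝ}
    (h : N.IsDAPIEquilibrium Ac θ p) {i j : Fin n} (hi : N.IsInverterNode i) (hj : N.IsInverterNode j) :
    N.injection θ i * Pbar j = N.injection θ j * Pbar i := by
  obtain ⟨haux, -⟩ := (N.isDAPIEquilibrium_iff hY hD hS hAc hconn θ p).1 h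
  rw [haux i, haux j]
  exact N.powerSharing hD hS hP hprop hi hj

/-- **Secondary control removes the frequency deviation**: the DAPI closed loop has a rest point (with
`θ̇ = 0`, i.e. every unit back at the rated frequency) iff the droop network has a synchronized
solution, i.e. iff (Aux) has an equilibrium (Theorem 2); the rest point is `(θ*, D ω_avg)`.
[cite: SimpsonporcoDorflerBullo2013, §5 Theorem 8 ((i) ⇔ (ii), equilibrium part)] -/
theorem exists_isDAPIEquilibrium_iff (hY : ∀ i j, N.Yabs i j = N.Yabs j i) (hD : ∀ i, 0 ≤ N.Dc i)
    (hS : 0 < ∑ i, N.Dc i) {Ac : Fin n → Fin n → ℝ} (hAc : ∀ i j, N.IsLoadNode j → Ac i j = 0)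
    (hconn : N.CommConnected Ac) :
    (∃ θ p : Fin n → ℝ, N.IsDAPIEquilibrium Ac θ p) ↔ ∃ θ : Fin n → ℝ, N.IsAuxEquilibrium θ := by
  constructor
  · rintro ⟨θ, p, h⟩
    exact ⟨θ, ((N.isDAPIEquilibrium_iff hY hD hS hAc hconn θ p).1 h).1⟩
  · rintro ⟨θ, hθ⟩
    exact ⟨θ, fun i => N.Dc i * N.avgFrequency,
      (N.isDAPIEquilibrium_iff hY hD hS hAc hconn θ _).2 ⟨hθ, fun i _ => rfl⟩⟩

/-! ## §6 Parallel inverters feeding one load (Corollary 4) — append 2026-08-27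

[cite: SimpsonporcoDorflerBullo2013, §3 Corollary 4 and its proof (arXiv:1206.5033 p0009 L32–L57)]:

> Corollary 4 (Existence and Stability of Sync'd Solution for Parallel Inverters). «Consider a parallel
> interconnection of inverters … The following two statements are equivalent: (i) Synchronization:
> There exists an arc length γ ∈ [0, π/2[ such that the closed-loop system (CombinedKuraDroop) possess a
> locally exponentially stable and unique synchronized solution t ↦ θ*(t) ∈ Δ_G(γ) for all t ≥ 0;
> (ii) Power Injection Feasibility: Γ ≜ max_{i∈V_I} |(P_i* − ω_avg D_i)/a_i0| < 1.»
> Proof: «there is one load fed by n − 1 inverters … B = [−1_{n−1} I_{n−1}]ᵀ … ξ is given uniquely …».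

Here the parallel (star) topology is carried nodally — every line joins the hub node `0` (`IsParallel`:
`|Y_ij| = 0` unless `i` or `j` is the hub) — so no edge list is needed: at a non-hub node the
injection is the single term `a_{i0} sin(θ_i − θ_0)`, the KCL flow of edge `{i,0}` IS `P̃_i`, and the
existence part of (i) ⇔ (ii) follows with `θ_i* − θ_0* = arcsin(P̃_i/a_{i0})`. The «locally
exponentially stable and unique» clause is NOT typed here (the hub is a load node, `D_0 = 0`, outside
the all-inverter stability theorem of `DroopSyncExponentialStability.lean`). -/

/-- Parallel (star) interconnection with hub node `hub`: lines only between the hub and the other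
nodes. [cite: SimpsonporcoDorflerBullo2013, §3 Corollary 4 («one load fed by n − 1 inverters»)] -/
def IsParallel (hub : Fin n) : Prop := ∀ i j, i ≠ hub → j ≠ hub → N.Yabs i j = 0

/-- In a star, the injection of a non-hub node is the single edge flow `a_{i,hub} sin(θ_i − θ_hub)`.
[cite: SimpsonporcoDorflerBullo2013, §3 Corollary 4 (proof: `B = [−1 I]ᵀ`)] -/
theorem injection_of_isParallel {hub : Fin n} (hpar : N.IsParallel hub) (θ : Fin n → ℝ) {i : Fin n}
    (hi : i ≠ hub) : N.injection θ i = N.a i hub * Real.sin (θ i - θ hub) := by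
  unfold injection
  rw [Finset.sum_eq_single hub]
  · intro j _ hj
    by_cases hji : j = i
    · rw [hji, sub_self, Real.sin_zero, mul_zero]
    · have : N.a i j = 0 := by unfold a; rw [hpar i j hi hj, mul_zero]
      rw [this, zero_mul]
  · intro h; exact absurd (Finset.mem_univ hub) h

/-- In a star with symmetric `|Y|`, the hub's injection is minus the sum of the spokes' flows.
[cite: SimpsonporcoDorflerBullo2013, §3 Corollary 4 (proof)] -/
theorem injection_hub_of_isParallel (hY : ∀ i j, N.Yabs i j = N.Yabs j i) {hub : Fin n}
    (θ : Fin n → ℝ) :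
    N.injection θ hub = -∑ j, (if j = hub then 0 else N.a j hub * Real.sin (θ j - θ hub)) := by
  unfold injection
  rw [← Finset.sum_neg_distrib]
  refine Finset.sum_congr rfl fun j _ => ?_
  by_cases hj : j = hub
  · rw [hj, if_pos rfl, sub_self, Real.sin_zero, mul_zero, neg_zero]
  · rw [if_neg hj]
    have ha : N.a hub j = N.a j hub := by unfold a; rw [hY hub j]; ring
    rw [ha, ← neg_sub (θ j) (θ hub), Real.sin_neg]
    ring

/-- **Corollary 4 (parallel inverters), existence part of (i) ⇔ (ii)**: for a star network with hub
`hub` (symmetric `|Y|`, `a_{i,hub} > 0` on the spokes, `Σ D_i ≠ 0`), there are an arc length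
`γ ∈ [0, π/2[` and an (Aux)-equilibrium `θ*` (= the angle array of a synchronized solution) with
`|θ*_i − θ*_hub| ≤ γ` on every spoke IF AND ONLY IF the power injection feasibility
`|P_i* − ω_avg D_i| < a_{i,hub}` holds at every non-hub node (`Γ < 1`). The local exponential
stability / uniqueness clause of (i) is NOT typed. [cite: SimpsonporcoDorflerBullo2013, §3 Corollary 4]
MODELLED: lossless droop microgrid (KuraDroop)–(PowerBal), star topology. -/
theorem parallel_sync_iff_feasible (hY : ∀ i j, N.Yabs i j = N.Yabs j i) (hD : ∑ i, N.Dc i ≠ 0)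
    {hub : Fin n} (hpar : N.IsParallel hub) (ha : ∀ i, i ≠ hub → 0 < N.a i hub) :
    (∃ γ : ℝ, 0 ≤ γ ∧ γ < Real.pi / 2 ∧ ∃ θ : Fin n → ℝ,
        (∀ i, i ≠ hub → |θ i - θ hub| ≤ γ) ∧ N.IsAuxEquilibrium θ) ↔
      ∀ i, i ≠ hub → |N.shiftedInjection i| < N.a i hub := by
  constructor
  · rintro ⟨γ, hγ0, hγ, θ, harc, haux⟩ i hi
    rw [← haux i, N.injection_of_isParallel hpar θ hi, abs_mul, abs_of_pos (ha i hi)]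
    have hsinγ : Real.sin γ < 1 := by
      rw [← Real.sin_pi_div_two]
      exact Real.strictMonoOn_sin ⟨by linarith [Real.pi_pos], le_of_lt hγ⟩
        ⟨by linarith [Real.pi_pos], le_refl _⟩ hγ
    have h1 := abs_sin_le_sin_of_abs_le (harc i hi) hγ.le
    have h2 : N.a i hub * |Real.sin (θ i - θ hub)| ≤ N.a i hub * Real.sin γ :=
      mul_le_mul_of_nonneg_left h1 (ha i hi).le
    have h3 : N.a i hub * Real.sin γ < N.a i hub := by
      have := mul_lt_mul_of_pos_left hsinγ (ha i hi)
      simpa using this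
    linarith
  · intro hF
    -- the printed angles: `θ_hub = 0`, `θ_i = arcsin(P̃_i / a_{i,hub})`
    set θ : Fin n → ℝ := fun i => if i = hub then 0 else Real.arcsin (N.shiftedInjection i / N.a i hub)
      with hθ
    have hθhub : θ hub = 0 := by simp [hθ]
    have hθi : ∀ i, i ≠ hub → θ i = Real.arcsin (N.shiftedInjection i / N.a i hub) := fun i hi => by
      simp [hθ, hi]
    have hratio : ∀ i, i ≠ hub →
        -1 < N.shiftedInjection i / N.a i hub ∧ N.shiftedInjection i / N.a i hub < 1 := by
      intro i hi
      have h := abs_lt.mp (hF i hi)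
      exact ⟨by rw [lt_div_iff₀ (ha i hi)]; linarith, by rw [div_lt_iff₀ (ha i hi)]; linarith⟩
    -- spokes: `P_e,i(θ) = P̃_i`
    have hspoke : ∀ i, i ≠ hub → N.injection θ i = N.shiftedInjection i := by
      intro i hi
      rw [N.injection_of_isParallel hpar θ hi, hθhub, sub_zero, hθi i hi,
        Real.sin_arcsin (hratio i hi).1.le (hratio i hi).2.le]
      field_simp [(ha i hi).ne']
    have hlt : ∀ i, |θ i - θ hub| < Real.pi / 2 := by
      intro i
      rw [hθhub, sub_zero]
      by_cases hi : i = hub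
      · rw [hi, hθhub, abs_zero]; exact by positivity
      · rw [hθi i hi, abs_lt]
        exact ⟨Real.neg_pi_div_two_lt_arcsin.mpr (hratio i hi).1,
          Real.arcsin_lt_pi_div_two.mpr (hratio i hi).2⟩
    -- the arc length: the largest spoke difference
    haveI : Nonempty (Fin n) := ⟨hub⟩
    obtain ⟨i₀, hi₀⟩ := Finite.exists_max (fun i => |θ i - θ hub|)
    refine ⟨|θ i₀ - θ hub|, abs_nonneg _, hlt i₀, θ, fun i _ => hi₀ i, fun i => ?_⟩
    by_cases hi : i = hub
    · -- hub: KCL, `Σ_i P̃_i = 0`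
      subst hi
      rw [N.injection_hub_of_isParallel hY θ]
      have hsum : ∑ j, (if j = i then 0 else N.a j i * Real.sin (θ j - θ i))
          = ∑ j, (if j = i then 0 else N.shiftedInjection j) := by
        refine Finset.sum_congr rfl fun j _ => ?_
        by_cases hj : j = i
        · simp [hj]
        · rw [if_neg hj, if_neg hj, ← N.injection_of_isParallel hpar θ hj, hspoke j hj]
      have htot := N.sum_shiftedInjection_eq_zero hD
      have hsplit : ∑ j, (if j = i then 0 else N.shiftedInjection j)
          = ∑ j, N.shiftedInjection j - N.shiftedInjection i := by
        have h1 : ∑ j, (if j = i then 0 else N.shiftedInjection j)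
            = ∑ j, (N.shiftedInjection j - if j = i then N.shiftedInjection j else 0) :=
          Finset.sum_congr rfl fun j _ => by by_cases hj : j = i <;> simp [hj]
        rw [h1, Finset.sum_sub_distrib, Finset.sum_ite_eq' Finset.univ i]
        simp
      rw [hsum, hsplit, htot]
      ring
    · exact hspoke i hi

end DroopNetwork

end Literature.MathematicalPhysics.PowerSystems

end
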